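import Summits.QuantumFields.QCD.Theses.SmallBetaInfraredSplit
import Summits.QuantumFields.QCD.Theorems.SmallBetaInfraredSplitWickSecondVariationAlgebra
import Literature.MathematicalPhysics.QuantumLattice.StaggeredMasslessDeterminant
import Literature.MathematicalPhysics.QuantumLattice.GrassmannIntegralProofs

/-!
# Route `SmallBetaInfraredSplit` (sub QCD) — support item `WickSecondVariation` (stmt-QuantumFields-23766), PROVED

For every `N, ν, L, β, φ` the mass-source generating function
`s ↦ ∫ Re det(D₀[U] + s·diag(−Δφ ⊗ 1_N)) d(e^{−βS_W} Haar)` is the evaluation of a real polynomial `p` with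
`p₀ = Z_β = ∫ Re det D₀[U]` and
`p₂ = ½ Σ_x Σ_y (−Δφ)_x (−Δφ)_y ∫ Re det D₀[U] · Re W_xy(D₀[U]⁻¹)` (the numerator of the route's kernel `G_β`).

Proof.  `Q_U(X) := det(X•A + D₀[U]) ∈ ℂ[X]`, `A = diag(−Δφ ∘ site)`, has degree `≤ N|Λ|` (Mathlib), its
coefficients are fixed linear combinations of the values `det(j•A + D₀[U])`, `j = 0,…,N|Λ|` (Lagrange; part 1
`…WickSecondVariationAlgebra`), hence continuous in `U` and integrable for the finite Wilson weight; so
`p := Σ_k (∫ Re Q_U,k) X^k` has the evaluation property (finite sum ↔ integral) and `p₀ = ∫ Re det D₀`.  For the second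
coefficient: on the invertible set `{det D₀[U] ≠ 0}` — of full measure for `ν ≥ 1` by the tree's
`StaggeredSingular.measure_pi_setOf_det_staggeredDirac_eq_zero` (`e^{−βS_W}` is a positive density) — Jacobi's
factorisation and the principal-minor expansion give `Q_U,2 = ½ ΣΣ (−Δφ)_x(−Δφ)_y det D₀·W_xy(D₀⁻¹)` (part 1), and
`W_xy(D₀⁻¹)` is REAL because `D₀⁻¹` is anti-Hermitian with `D₀` (tree: `staggeredDirac_antihermitian_massless_holds`),
so `Re(det·W) = Re det · Re W` — no parity hypothesis on `L` is needed; for `ν = 0` both sides vanish (`Δ = 0` on a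
point).  The exchange of `∫` with `Σ_x Σ_y` uses integrability of each `Re det · Re W_xy`, obtained by POLARISATION:
`det·W_xy = Q^{δ_x+δ_y}_2 − Q^{δ_x}_2 − Q^{δ_y}_2` a.e., a continuous function.

HONEST FRAMING: a support item (finite-dimensional algebra and bookkeeping) of a DRAFT-by-design QCD-side line
(LADDER-YM rung Q1, RECORD label); the crux `GaussianDominationSmallBeta` (23765), `NeighbourFloorSmallBeta` (27241)
and the leaf `SalmhoferSeilerSmallBeta` stay OPEN; nothing about `QCD`, `YangMills`, a mass gap or a continuum limit is
proved here. [cite: SalmhoferSeiler1991, §2 (2.10)–(2.12), §3 (3.95)–(3.99)]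
-/

set_option autoImplicit false

namespace Summit.QuantumFields.QCD.Theorems.SmallBetaInfraredSplit

open MeasureTheory Matrix Complex Finset Filter Polynomial
open Literature.MathematicalPhysics.QuantumFieldTheory
open Literature.MathematicalPhysics.QuantumLattice
open Literature.MathematicalPhysics.StatisticalMechanics
open Literature.Probability.LatticeModels (TorusSite)
open StaggeredSingular (D0 UN)
open WickAlgebra

section Model

variable {ν L N : ℕ} [NeZero L]

/-- `U ↦ det(c•A + D₀[U])` is continuous. [cite: SalmhoferSeiler1991, §2 (2.11)] -/
theorem continuous_det_smul_add_D0 (A : Matrix (TorusSite ν L × Fin N) (TorusSite ν L × Fin N) ℂ) (c : ℂ) :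
    Continuous fun U : GaugeConfig ν L (UN N) => (c • A + D0 U).det :=
  (continuous_const.add StaggeredSingular.continuous_D0).matrix_det

/-- The coefficients of `Q_U = det(X•A + D₀[U])` are continuous in the gauge field (Lagrange formula).
[cite: SalmhoferSeiler1991, §2 (2.11)] -/
theorem continuous_coeff_det (A : Matrix (TorusSite ν L × Fin N) (TorusSite ν L × Fin N) ℂ) (k : ℕ) :
    Continuous fun U : GaugeConfig ν L (UN N) =>
      (det ((X : ℂ[X]) • A.map C + (D0 U).map C)).coeff k := by
  simp only [coeff_det_X_smul_add_eq_sum_lagrange]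
  exact continuous_finsetSum _ fun j _ => continuous_const.mul (continuous_det_smul_add_D0 A _)

/-- … hence their real parts are integrable for the (finite) Wilson weight at every `β`.
[cite: SalmhoferSeiler1991, §2 (2.11)–(2.12)] -/
theorem integrable_coeff_det_re (A : Matrix (TorusSite ν L × Fin N) (TorusSite ν L × Fin N) ℂ) (k : ℕ)
    (β : ℝ) :
    Integrable (fun U : GaugeConfig ν L (UN N) => ((det ((X : ℂ[X]) • A.map C + (D0 U).map C)).coeff k).re)
      (wilsonWeight (d := ν) (L := L) (unitaryFundamentalRep (Fin N) ℂ) β) := by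
  haveI := StrongCoupling.isFiniteMeasure_wilsonWeight (ν := ν) (L := L) (N := N) β
  exact (Complex.continuous_re.comp (continuous_coeff_det A k)).integrable_of_hasCompactSupport
    (HasCompactSupport.of_compactSpace _)

/-- **The second coefficient on the invertible set** (Jacobi + principal minors + site regrouping):
`2·Q_U,2 = Σ_x Σ_y c_x c_y · det D₀[U] · W_xy(D₀[U]⁻¹)` for `A = diag(c ∘ site)` and `det D₀[U]` a unit.
[cite: SalmhoferSeiler1991, §2 (2.10)–(2.11)] -/
theorem two_mul_coeff_two_det_eq (c : TorusSite ν L → ℂ) (U : GaugeConfig ν L (UN N))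
    (hU : IsUnit (D0 U).det) :
    2 * (det ((X : ℂ[X]) • (diagonal fun i : TorusSite ν L × Fin N => c i.1).map C + (D0 U).map C)).coeff 2 =
      ∑ x, ∑ y, c x * c y * ((D0 U).det *
        ((∑ a : Fin N, (D0 U)⁻¹ (x, a) (x, a)) * (∑ b : Fin N, (D0 U)⁻¹ (y, b) (y, b)) -
          ∑ a : Fin N, ∑ b : Fin N, (D0 U)⁻¹ (x, a) (y, b) * (D0 U)⁻¹ (y, b) (x, a))) := by
  rw [coeff_two_det_X_smul_add _ _ hU, mul_left_comm, two_mul_sum_powersetCard_two_det]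
  have h := sum_sum_mul_diagonal_eq (D0 U)⁻¹ c
  dsimp only at h
  rw [h, Finset.mul_sum]
  refine Finset.sum_congr rfl fun x _ => ?_
  rw [Finset.mul_sum]
  exact Finset.sum_congr rfl fun y _ => by ring

/-- `D₀[U]⁻¹` is anti-Hermitian (with `D₀[U]`; junk `0` on the singular set included).
[cite: SalmhoferSeiler1991, §2 (2.3)] -/
theorem conjTranspose_inv_D0 (U : GaugeConfig ν L (UN N)) : ((D0 U)⁻¹)ᴴ = -(D0 U)⁻¹ := by
  have hanti : (D0 U)ᴴ = -D0 U :=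
    staggeredDirac_antihermitian_massless_holds (unitaryFundamentalRep (Fin N) ℂ)
      StrongCoupling.unitaryFundamentalRep_mem U
  rw [conjTranspose_nonsing_inv, hanti, inv_neg_eq]

/-- The Wick form `W_xy(D₀[U]⁻¹)` is real, for every gauge field. [cite: SalmhoferSeiler1991, §2 (2.10)–(2.11)] -/
theorem wick_inv_D0_im (U : GaugeConfig ν L (UN N)) (x y : TorusSite ν L) :
    ((∑ a : Fin N, (D0 U)⁻¹ (x, a) (x, a)) * (∑ b : Fin N, (D0 U)⁻¹ (y, b) (y, b)) -
        ∑ a : Fin N, ∑ b : Fin N, (D0 U)⁻¹ (x, a) (y, b) * (D0 U)⁻¹ (y, b) (x, a)).im = 0 :=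
  wick_im_eq_zero_of_conjTranspose_eq_neg _ (conjTranspose_inv_D0 U) x y

/-- **Real form of the second coefficient on the invertible set**, for a REAL source `a`:
`Re Q_U,2 = ½ Σ_x Σ_y a_x a_y · Re det D₀[U] · Re W_xy(D₀[U]⁻¹)`. [cite: SalmhoferSeiler1991, §2 (2.10)–(2.12)] -/
theorem coeff_two_re_eq (a : TorusSite ν L → ℝ) (U : GaugeConfig ν L (UN N)) (hU : IsUnit (D0 U).det) :
    ((det ((X : ℂ[X]) • (diagonal fun i : TorusSite ν L × Fin N => ((a i.1 : ℝ) : ℂ)).map C +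
        (D0 U).map C)).coeff 2).re =
      (1 / 2 : ℝ) * ∑ x, ∑ y, a x * a y * (((D0 U).det).re *
        ((∑ a : Fin N, (D0 U)⁻¹ (x, a) (x, a)) * (∑ b : Fin N, (D0 U)⁻¹ (y, b) (y, b)) -
          ∑ a : Fin N, ∑ b : Fin N, (D0 U)⁻¹ (x, a) (y, b) * (D0 U)⁻¹ (y, b) (x, a)).re) := by
  have h := congrArg Complex.re (two_mul_coeff_two_det_eq (fun x => ((a x : ℝ) : ℂ)) U hU)
  have h2 : ∀ z : ℂ, ((2 : ℂ) * z).re = 2 * z.re := fun z => by simp [Complex.mul_re]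
  rw [h2, Complex.re_sum] at h
  simp_rw [Complex.re_sum] at h
  have h3 : ∀ x y : TorusSite ν L, (((a x : ℝ) : ℂ) * ((a y : ℝ) : ℂ) * ((D0 U).det *
      ((∑ a : Fin N, (D0 U)⁻¹ (x, a) (x, a)) * (∑ b : Fin N, (D0 U)⁻¹ (y, b) (y, b)) -
        ∑ a : Fin N, ∑ b : Fin N, (D0 U)⁻¹ (x, a) (y, b) * (D0 U)⁻¹ (y, b) (x, a)))).re =
      a x * a y * (((D0 U).det).re *
        ((∑ a : Fin N, (D0 U)⁻¹ (x, a) (x, a)) * (∑ b : Fin N, (D0 U)⁻¹ (y, b) (y, b)) -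
          ∑ a : Fin N, ∑ b : Fin N, (D0 U)⁻¹ (x, a) (y, b) * (D0 U)⁻¹ (y, b) (x, a)).re) := by
    intro x y
    rw [← Complex.ofReal_mul, Complex.re_ofReal_mul, Complex.mul_re, wick_inv_D0_im, mul_zero, sub_zero]
  simp only [h3] at h
  linarith

variable [NeZero ν]

/-- `det D₀[U]` is a unit for `e^{−βS_W}Haar`-almost every gauge field (`ν ≥ 1`, every `β`).
[cite: SalmhoferSeiler1991, §2 (2.11)–(2.12)] -/
theorem ae_isUnit_det_D0 (β : ℝ) :
    ∀ᵐ U ∂(wilsonWeight (d := ν) (L := L) (unitaryFundamentalRep (Fin N) ℂ) β), IsUnit (D0 U).det := by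
  have h0 : wilsonWeight (d := ν) (L := L) (unitaryFundamentalRep (Fin N) ℂ) β
      {U : GaugeConfig ν L (UN N) | (D0 U).det = 0} = 0 :=
    (StrongCoupling.wilsonWeight_apply_eq_zero_iff β _).2
      StaggeredSingular.measure_pi_setOf_det_staggeredDirac_eq_zero
  rw [ae_iff]
  have hset : {U : GaugeConfig ν L (UN N) | ¬IsUnit (D0 U).det} =
      {U : GaugeConfig ν L (UN N) | (D0 U).det = 0} := by
    ext U
    simp only [Set.mem_setOf_eq, isUnit_iff_ne_zero, not_not]
  rw [hset, h0]

/-- **Integrability of the Wick numerator** `U ↦ Re det D₀[U] · Re W_xy(D₀[U]⁻¹)` at every `β`, by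
POLARISATION: a.e. `2 det·W_xy = 2Q₂^{δ_x+δ_y} − 2Q₂^{δ_x} − 2Q₂^{δ_y}`, a continuous function.
[cite: SalmhoferSeiler1991, §2 (2.10)–(2.12)] -/
theorem integrable_det_re_mul_wick_re (β : ℝ) (x y : TorusSite ν L) :
    Integrable (fun U : GaugeConfig ν L (UN N) => ((D0 U).det).re *
        ((∑ a : Fin N, (D0 U)⁻¹ (x, a) (x, a)) * (∑ b : Fin N, (D0 U)⁻¹ (y, b) (y, b)) -
          ∑ a : Fin N, ∑ b : Fin N, (D0 U)⁻¹ (x, a) (y, b) * (D0 U)⁻¹ (y, b) (x, a)).re)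
      (wilsonWeight (d := ν) (L := L) (unitaryFundamentalRep (Fin N) ℂ) β) := by
  haveI := StrongCoupling.isFiniteMeasure_wilsonWeight (ν := ν) (L := L) (N := N) β
  -- the three polarising sources
  set δ : TorusSite ν L → TorusSite ν L → ℂ := fun z u => if u = z then 1 else 0 with hδ
  set Φ : (TorusSite ν L → ℂ) → GaugeConfig ν L (UN N) → ℂ := fun c U =>
    (det ((X : ℂ[X]) • (diagonal fun i : TorusSite ν L × Fin N => c i.1).map C + (D0 U).map C)).coeff 2
    with hΦ
  set T : GaugeConfig ν L (UN N) → TorusSite ν L → TorusSite ν L → ℂ := fun U u v => (D0 U).det *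
    ((∑ a : Fin N, (D0 U)⁻¹ (u, a) (u, a)) * (∑ b : Fin N, (D0 U)⁻¹ (v, b) (v, b)) -
      ∑ a : Fin N, ∑ b : Fin N, (D0 U)⁻¹ (u, a) (v, b) * (D0 U)⁻¹ (v, b) (u, a)) with hT
  have hcont : ∀ c : TorusSite ν L → ℂ, Continuous (Φ c) := fun c => continuous_coeff_det _ 2
  set g : GaugeConfig ν L (UN N) → ℝ := fun U =>
    ((2 * Φ (δ x + δ y) U - 2 * Φ (δ x) U - 2 * Φ (δ y) U).re) / 2 with hg
  have hgint : Integrable g (wilsonWeight (d := ν) (L := L) (unitaryFundamentalRep (Fin N) ℂ) β) := by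
    have hgc : Continuous g :=
      (Complex.continuous_re.comp (((continuous_const.mul (hcont _)).sub
        (continuous_const.mul (hcont _))).sub (continuous_const.mul (hcont _)))).div_const _
    exact hgc.integrable_of_hasCompactSupport (HasCompactSupport.of_compactSpace _)
  refine hgint.congr ?_
  filter_upwards [ae_isUnit_det_D0 (ν := ν) (L := L) (N := N) β] with U hU
  -- bilinear expansion of the polarised sources
  have hS : ∀ c : TorusSite ν L → ℂ, 2 * Φ c U = ∑ u, ∑ v, c u * c v * T U u v := fun c =>
    two_mul_coeff_two_det_eq c U hU
  have hδsum : ∀ z z' : TorusSite ν L, ∑ u, ∑ v, δ z u * δ z' v * T U u v = T U z z' := by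
    intro z z'
    simp only [hδ]
    rw [Finset.sum_eq_single_of_mem z (Finset.mem_univ _) (fun u _ hu => by simp [hu]),
      Finset.sum_eq_single_of_mem z' (Finset.mem_univ _) (fun v _ hv => by simp [hv])]
    simp
  have hsym : T U y x = T U x y := by
    simp only [hT]
    rw [mul_comm (∑ a : Fin N, (D0 U)⁻¹ (y, a) (y, a)), Finset.sum_comm (f := fun a b =>
      (D0 U)⁻¹ (y, a) (x, b) * (D0 U)⁻¹ (x, b) (y, a))]
    congr 2
    exact Finset.sum_congr rfl fun a _ => Finset.sum_congr rfl fun b _ => by ring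
  have hpol : 2 * Φ (δ x + δ y) U - 2 * Φ (δ x) U - 2 * Φ (δ y) U = 2 * T U x y := by
    rw [hS, hS, hS]
    simp only [Pi.add_apply, add_mul, mul_add, Finset.sum_add_distrib, hδsum, hsym]
    ring
  show g U = _
  rw [hg]
  dsimp only
  rw [hpol]
  have h2 : ((2 : ℂ) * T U x y).re = 2 * (T U x y).re := by simp [Complex.mul_re]
  rw [h2, hT]
  dsimp only
  rw [Complex.mul_re, wick_inv_D0_im, mul_zero, sub_zero]
  ring

end Model

/-- `−Δφ = 0` on the one-point torus `ν = 0`. [folklore] -/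
theorem neg_laplacian_eq_zero_of_dim_zero {L : ℕ} (φ : TorusSite 0 L → ℝ) (x : TorusSite 0 L) :
    -ComplexSpin.laplacian φ x = 0 := by
  simp [ComplexSpin.laplacian]

/-- The route's support item `WickSecondVariation` (stmt-QuantumFields-23766) BY NAME.
[cite: SalmhoferSeiler1991, §2 (2.10)–(2.12), §3 (3.95)–(3.99)] -/
theorem wickSecondVariation_proof :
    Summit.QuantumFields.QCD.Theses.SmallBetaInfraredSplit.WickSecondVariation := by
  intro N ν L _ β φ
  haveI := StrongCoupling.isFiniteMeasure_wilsonWeight (ν := ν) (L := L) (N := N) β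
  -- the polynomial matrix pencil
  set A : Matrix (TorusSite ν L × Fin N) (TorusSite ν L × Fin N) ℂ :=
    diagonal fun i : TorusSite ν L × Fin N => ((-ComplexSpin.laplacian φ i.1 : ℝ) : ℂ) with hA
  set Q : GaugeConfig ν L (UN N) → ℂ[X] := fun U => det ((X : ℂ[X]) • A.map C + (D0 U).map C) with hQ
  set n : ℕ := Fintype.card (TorusSite ν L × Fin N) with hn
  set w := wilsonWeight (d := ν) (L := L) (unitaryFundamentalRep (Fin N) ℂ) β with hw
  have hdeg : ∀ U, (Q U).natDegree < n + 3 := fun U =>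
    lt_of_le_of_lt (Polynomial.natDegree_det_X_add_C_le _ _) (by omega)
  have hint : ∀ k, Integrable (fun U => ((Q U).coeff k).re) w := fun k => integrable_coeff_det_re A k β
  -- coefficient extraction for the explicit polynomial
  set p : ℝ[X] := ∑ k ∈ Finset.range (n + 3), C (∫ U, ((Q U).coeff k).re ∂w) * X ^ k with hp
  have hcoeff : ∀ k, k < n + 3 → p.coeff k = ∫ U, ((Q U).coeff k).re ∂w := by
    intro k hk
    rw [hp, finsetSum_coeff]
    simp only [coeff_C_mul_X_pow]
    rw [Finset.sum_ite_eq, if_pos (Finset.mem_range.2 hk)]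
  refine ⟨p, fun s => ?_, ?_, ?_⟩
  · -- evaluation: finite sum ↔ integral
    have hpt : ∀ U : GaugeConfig ν L (UN N),
        (det (D0 U + diagonal fun i : TorusSite ν L × Fin N =>
          ((s * (-ComplexSpin.laplacian φ i.1) : ℝ) : ℂ))).re =
        ∑ k ∈ Finset.range (n + 3), ((Q U).coeff k).re * s ^ k := by
      intro U
      have e1 : D0 U + diagonal (fun i : TorusSite ν L × Fin N =>
          ((s * (-ComplexSpin.laplacian φ i.1) : ℝ) : ℂ)) = (s : ℂ) • A + D0 U := by
        rw [hA, add_comm]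
        congr 1
        ext i j
        simp only [Matrix.smul_apply, diagonal_apply, smul_eq_mul, mul_ite, mul_zero]
        split_ifs
        · push_cast; ring
        · rfl
      rw [e1, ← eval_det_X_smul_add, Polynomial.eval_eq_sum_range' (hdeg U), Complex.re_sum]
      refine Finset.sum_congr rfl fun k _ => ?_
      rw [← Complex.ofReal_pow, Complex.re_mul_ofReal]
    have hev : p.eval s = ∑ k ∈ Finset.range (n + 3), (∫ U, ((Q U).coeff k).re ∂w) * s ^ k := by
      rw [hp, eval_finsetSum]
      simp only [eval_mul, eval_C, eval_pow, eval_X]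
    show ∫ U, (det (D0 U + diagonal fun i : TorusSite ν L × Fin N =>
          ((s * (-ComplexSpin.laplacian φ i.1) : ℝ) : ℂ))).re ∂w = p.eval s
    simp_rw [hpt]
    rw [hev, integral_finsetSum _ fun k _ => (hint k).mul_const _]
    exact Finset.sum_congr rfl fun k _ => integral_mul_const _ _
  · -- constant coefficient
    rw [hcoeff 0 (by omega)]
    show ∫ U, ((Q U).coeff 0).re ∂w = ∫ U, ((D0 U).det).re ∂w
    refine integral_congr_ae (Eventually.of_forall fun U => ?_)
    simp only [hQ, Polynomial.coeff_det_X_add_C_zero]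
  · -- second coefficient
    rw [hcoeff 2 (by omega)]
    rcases Nat.eq_zero_or_pos ν with hν | hν
    · -- `ν = 0`: `−Δφ = 0`, both sides vanish
      subst hν
      have hA0 : A = 0 := by
        rw [hA]
        ext i j
        simp only [diagonal_apply, neg_laplacian_eq_zero_of_dim_zero, Complex.ofReal_zero, ite_self,
          Matrix.zero_apply]
      have hQ2 : ∀ U, (Q U).coeff 2 = 0 := by
        intro U
        simp only [hQ, hA0, Matrix.map_zero _ (map_zero C), smul_zero, zero_add]
        have : ((D0 U).map (C : ℂ → ℂ[X])).det = C (D0 U).det := by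
          have := (RingHom.map_det (C : ℂ →+* ℂ[X]) (D0 U)).symm
          rwa [RingHom.mapMatrix_apply] at this
        rw [this, coeff_C]
        simp
      simp only [hQ2, Complex.zero_re, integral_zero, neg_laplacian_eq_zero_of_dim_zero, zero_mul,
        Finset.sum_const_zero, mul_zero]
    · haveI : NeZero ν := ⟨by omega⟩
      have hae : ∀ᵐ U ∂w, ((Q U).coeff 2).re =
          (1 / 2 : ℝ) * ∑ x, ∑ y, (-ComplexSpin.laplacian φ x) * (-ComplexSpin.laplacian φ y) *
            (((D0 U).det).re *
              ((∑ a : Fin N, (D0 U)⁻¹ (x, a) (x, a)) * (∑ b : Fin N, (D0 U)⁻¹ (y, b) (y, b)) -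
                ∑ a : Fin N, ∑ b : Fin N, (D0 U)⁻¹ (x, a) (y, b) * (D0 U)⁻¹ (y, b) (x, a)).re) := by
        filter_upwards [ae_isUnit_det_D0 (ν := ν) (L := L) (N := N) β] with U hU
        exact coeff_two_re_eq (fun x => -ComplexSpin.laplacian φ x) U hU
      rw [integral_congr_ae hae, integral_const_mul]
      dsimp only
      congr 1
      rw [integral_finsetSum _ fun x _ => integrable_finsetSum _ fun y _ =>
        (integrable_det_re_mul_wick_re β x y).const_mul _]
      refine Finset.sum_congr rfl fun x _ => ?_
      rw [integral_finsetSum _ fun y _ => (integrable_det_re_mul_wick_re β x y).const_mul _]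
      refine Finset.sum_congr rfl fun y _ => ?_
      rw [integral_const_mul]

end Summit.QuantumFields.QCD.Theorems.SmallBetaInfraredSplit
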